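import Summits.NavierStokesRegularity.NavierStokesRegularity.Theorems.ScenarioCensusRowA5FsSlice
import HarnessLib

/-!
# Census rows A5fe / A5fi (ns-idea-4 LINE «one-cycle» = the Feller–swirl dictionary) — part 4/7: §5 the one-cycle contraction (O2 from S1–S3), §5b O1 from S3 alone, §5c the critical threshold statements (S3⁰, O2⁰), §3b engine helpers

Part 4 of 7 of the port of `OneCycle_v2_3.lean` (sha16 f100b791173babd1); see `ScenarioCensusRowA5FsBox.lean` for the port note.
No census value is asserted here; Row_A5 and NS regularity are NOT proved; no summit statement is proved by this file.
-/

noncomputable section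
set_option linter.dupNamespace false

open MeasureTheory Set Function Filter Topology InnerProductSpace
open scoped Laplacian RealInnerProductSpace ContDiff ENNReal

namespace Summit.NavierStokesRegularity.NavierStokesRegularity.Theorems.ScenarioCensus.FellerSwirl

open Literature.Analysis.FluidPDE
open Summit.NavierStokesRegularity.NavierStokesRegularity.Theorems.ScenarioCensus (Row_A5 Row_A5fe Row_A5fi row_A5fi_of_row_A5fe)

/-! ## §5  The ONE-CYCLE contraction (PROVED): S2 + S3 ⇒ `sup |f| ≤ (1 − p₀) sup |f|` ⇒ `f ≡ 0`, i.e. O2 -/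

/-- PROVED. **The one-cycle composition**: `CoreLeak → FarTransport → EventualFellerCore`. With `R₁ = max R₀ 1` and
`F_n = (1 − p₀)^n C_f`: `|f| ≤ F_n` everywhere ⇒ (S2) `|f| ≤ (1−p₀)F_n` on the core ⇒ (S3) `|f| ≤ F_{n+1}` everywhere;
`F_n → 0`. -/
theorem eventualFellerCore_of_steps (hA : CoreLeak) (hB : FarTransport) : EventualFellerCore := by
  intro f u Cf Cg Cu δ R₀ hδ h1 h2 h3 h4 hM h6 h7 hone h8
  have hp : IsSwirlPair f u Cg Cu := ⟨h1, h2, h3, h4, h6, h7, h8⟩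
  set R₁ : ℝ := max R₀ 1 with hR₁
  have hR₁pos : 0 < R₁ := lt_of_lt_of_le one_pos (le_max_right _ _)
  have hone' : ∀ t < 0, ∀ x, R₁ ≤ cylRadius x → -(2 - δ) ≤ x 0 * u t x 0 + x 1 * u t x 1 :=
    fun t ht x hx => hone t ht x ((le_max_left _ _).trans hx)
  obtain ⟨p₀, hp₀, hp₁, hcore⟩ := hA Cu R₁ hR₁pos
  have key : ∀ n : ℕ, ∀ t < 0, ∀ x, |f t x| ≤ (1 - p₀) ^ n * Cf := by
    intro n
    induction n with
    | zero => intro t ht x; simpa using hM t ht x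
    | succ n ih =>
      intro t ht x
      have hA' := hcore f u Cg ((1 - p₀) ^ n * Cf) hp ih
      have hB' := hB f u Cg Cu δ R₁ ((1 - p₀) ^ n * Cf) ((1 - p₀) * ((1 - p₀) ^ n * Cf)) hp hδ hR₁pos
        hone' ih hA' t ht x
      calc |f t x| ≤ (1 - p₀) * ((1 - p₀) ^ n * Cf) := hB'
        _ = (1 - p₀) ^ (n + 1) * Cf := by ring
  intro t ht x
  have hlim : Tendsto (fun n : ℕ => (1 - p₀) ^ n * Cf) atTop (𝓝 (0 * Cf)) :=
    (tendsto_pow_atTop_nhds_zero_of_lt_one (by linarith) (by linarith)).mul_const Cf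
  have hle : |f t x| ≤ 0 * Cf := ge_of_tendsto' hlim fun n => key n t ht x
  rw [zero_mul] at hle
  exact abs_eq_zero.1 (le_antisymm hle (abs_nonneg _))

/-- PROVED. **The skeleton composition concluding O2 BY NAME from the registered stubs' statements**:
`BoxComparison → (BoxComparison → CoreLeak) → (BoxComparison → FarTransport) → EventualFellerCore`. -/
theorem eventualFellerCore_of (h₁ : BoxComparison) (h₂ : BoxComparison → CoreLeak)
    (h₃ : BoxComparison → FarTransport) : EventualFellerCore :=
  eventualFellerCore_of_steps (h₂ h₁) (h₃ h₁)

/-! ## §5b  (v1.1, PROVED) O1 needs NO core-leak step: under the GLOBAL inflow bound, S3 alone — run with the core bound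
`F₁ = max C_g 0 · R₁` supplied by the axis condition, then `R₁ ↓ 0` — gives `f ≡ 0`. So row A5fi costs S1 + S3 + S4 only;
the core-leak step S2 is exactly what the EVENTUAL version (row A5fe) adds. -/

/-- PROVED (v1.1). `FarTransport → FellerCore`. -/
theorem fellerCore_of_farTransport (hB : FarTransport) : FellerCore := by
  intro f u Cf Cg Cu δ hδ h1 h2 h3 h4 hM h6 h7 hone h8
  have hp : IsSwirlPair f u Cg Cu := ⟨h1, h2, h3, h4, h6, h7, h8⟩
  have hC : 0 ≤ max Cg 0 := le_max_right _ _
  have key : ∀ R₁ : ℝ, 0 < R₁ → ∀ t < 0, ∀ x, |f t x| ≤ max Cg 0 * R₁ := by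
    intro R₁ hR₁
    refine hB f u Cg Cu δ R₁ Cf (max Cg 0 * R₁) hp hδ hR₁ (fun t ht x _ => hone t ht x) hM ?_
    intro s hs y hy
    calc |f s y| ≤ Cg * cylRadius y := h4 s hs y
      _ ≤ max Cg 0 * cylRadius y := mul_le_mul_of_nonneg_right (le_max_left _ _) (cylRadius_nonneg y)
      _ ≤ max Cg 0 * R₁ := mul_le_mul_of_nonneg_left hy hC
  intro t ht x
  have h0 : |f t x| ≤ 0 := by
    refine le_of_forall_pos_lt_add fun ε hε => ?_
    have h := key (ε / (max Cg 0 + 1)) (by positivity) t ht x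
    have hlt : max Cg 0 * (ε / (max Cg 0 + 1)) < ε := by
      rw [mul_div_assoc', div_lt_iff₀ (by positivity)]
      nlinarith
    linarith
  exact abs_eq_zero.1 (le_antisymm h0 (abs_nonneg _))

/-! ## §5c  (v1.1) THE CRITICAL THRESHOLD: inflow number `≤ 2` EXACTLY suffices (log barrier), and above it the
passive class is NOT Liouville (certified explicit pair). Dictionary: a Bessel process of dimension exactly `2` is still
(neighbourhood-)recurrent — its scale function `log r` is unbounded — while dimension `2 + δ` is transient. -/

/-- PROVED (v1.1, dictionary row «critical»). **The log profile is a super-solution up to and including the threshold**: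
for `χ(r) = log r` (`χ′ = 1/r`, `χ″ = −1/r²`): `χ″ + ((m−1)/r)χ′ = (m − 2)/r² ≤ 0` iff `m ≤ 2`. -/
theorem logProfile_supersolution {r m : ℝ} (hr : 0 < r) (hm : m ≤ 2) :
    -(1 / r ^ 2) + (m - 1) / r * (1 / r) ≤ 0 := by
  have h : -(1 / r ^ 2) + (m - 1) / r * (1 / r) = (m - 2) / r ^ 2 := by
    field_simp
    ring
  rw [h]
  exact div_nonpos_of_nonpos_of_nonneg (by linarith) (by positivity)

/-- PROVED (v1.1). And it FAILS just above: for `m > 2` the log profile is a strict sub-solution. -/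
theorem logProfile_fails {r m : ℝ} (hr : 0 < r) (hm : 2 < m) :
    0 < -(1 / r ^ 2) + (m - 1) / r * (1 / r) := by
  have h : -(1 / r ^ 2) + (m - 1) / r * (1 / r) = (m - 2) / r ^ 2 := by
    field_simp
    ring
  rw [h]
  exact div_pos (by linarith) (by positivity)

/-- **S3⁰ `CriticalFarTransport` (support, provable now given S1, M; v1.1 SHARPENING of S3).** The far-transport step at
the EXACT threshold: inflow number `≤ 2` (not `2 − δ`) on `{r ≥ R₁}` suffices — same proof plan as S3 with the main
profile `F₁ + (F − F₁) log(r/R₁)/log(R/R₁)` (`logProfile_supersolution`; for fixed `r*`, `log(r*/R₁)/log(R/R₁) → 0` as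
`R → ∞`) in place of the power profile; the two correctors are unchanged. Why it might fail: bookkeeping only. -/
def CriticalFarTransport : Prop :=
  ∀ (f : ℝ → E3 → ℝ) (u : ℝ → E3 → E3) (Cg Cu R₁ F F₁ : ℝ), IsSwirlPair f u Cg Cu → 0 < R₁ →
    (∀ t < 0, ∀ x, R₁ ≤ cylRadius x → -2 ≤ x 0 * u t x 0 + x 1 * u t x 1) →
      (∀ t < 0, ∀ x, |f t x| ≤ F) →
        (∀ t < 0, ∀ x, cylRadius x ≤ R₁ → |f t x| ≤ F₁) →
          ∀ t < 0, ∀ x, |f t x| ≤ F₁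

/-- PROVED (v1.1). `CriticalFarTransport → FarTransport` (`m ≤ 2 − δ ⇒ m ≤ 2`). -/
theorem farTransport_of_critical (h : CriticalFarTransport) : FarTransport := by
  intro f u Cg Cu δ R₁ F F₁ hp hδ hR₁ hone hF hF₁
  exact h f u Cg Cu R₁ F F₁ hp hR₁ (fun t ht x hx => by have h' := hone t ht x hx; linarith) hF hF₁

/-- **O2⁰ `CriticalEventualFellerCore` (v1.1).** O2 with the eventual inflow hypothesis weakened to the exact threshold
`−(x₀u₀ + x₁u₁) ≤ 2` on `{r ≥ R₀}` (no `δ`). Implies O2 (`eventualFellerCore_of_critical`, PROVED) and follows from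
S2 + S3⁰ (`criticalEventualFellerCore_of_steps`, PROVED). The NS-side rows sharpen accordingly (K1 of feller-swirl may be
weakened to an eventual bound `≤ 2`); not re-typed here to keep the obligation count. -/
def CriticalEventualFellerCore : Prop :=
  ∀ (f : ℝ → E3 → ℝ) (u : ℝ → E3 → E3) (Cf Cg Cu R₀ : ℝ),
    (∀ t < 0, ContDiff ℝ ∞ (f t)) →
    ContinuousOn (fun p : ℝ × E3 => fderiv ℝ (f p.1) p.2) (Iio 0 ×ˢ univ) →
    ContinuousOn (fun p : ℝ × E3 => (Δ (f p.1)) p.2) (Iio 0 ×ˢ univ) →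
    (∀ t < 0, ∀ x, |f t x| ≤ Cg * cylRadius x) →
    (∀ t < 0, ∀ x, |f t x| ≤ Cf) →
    Measurable (uncurry u) →
    (∀ t < 0, ∀ x, ‖u t x‖ ≤ Cu) →
    (∀ t < 0, ∀ x, R₀ ≤ cylRadius x → -2 ≤ x 0 * u t x 0 + x 1 * u t x 1) →
    (∀ x, cylRadius x ≠ 0 → ∀ s t : ℝ, s ≤ t → t < 0 →
      f t x - f s x = ∫ τ in s..t, ((Δ (f τ)) x - fderiv ℝ (f τ) x (u τ x) -
        2 / cylRadius x * partialDeriv (eR x) (f τ) x)) →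
    ∀ t < 0, ∀ x, f t x = 0

/-- PROVED (v1.1). `CriticalEventualFellerCore → EventualFellerCore`. -/
theorem eventualFellerCore_of_critical (h : CriticalEventualFellerCore) : EventualFellerCore := by
  intro f u Cf Cg Cu δ R₀ hδ h1 h2 h3 h4 hM h6 h7 hone h8
  exact h f u Cf Cg Cu R₀ h1 h2 h3 h4 hM h6 h7 (fun t ht x hx => by have h' := hone t ht x hx; linarith) h8

/-- PROVED (v1.1). **The one-cycle contraction at the exact threshold**: `CoreLeak → CriticalFarTransport →
CriticalEventualFellerCore` (same induction `F_{n+1} = (1 − p₀)F_n`). -/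
theorem criticalEventualFellerCore_of_steps (hA : CoreLeak) (hB : CriticalFarTransport) :
    CriticalEventualFellerCore := by
  intro f u Cf Cg Cu R₀ h1 h2 h3 h4 hM h6 h7 hone h8
  have hp : IsSwirlPair f u Cg Cu := ⟨h1, h2, h3, h4, h6, h7, h8⟩
  set R₁ : ℝ := max R₀ 1 with hR₁
  have hR₁pos : 0 < R₁ := lt_of_lt_of_le one_pos (le_max_right _ _)
  have hone' : ∀ t < 0, ∀ x, R₁ ≤ cylRadius x → -2 ≤ x 0 * u t x 0 + x 1 * u t x 1 :=
    fun t ht x hx => hone t ht x ((le_max_left _ _).trans hx)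
  obtain ⟨p₀, hp₀, hp₁, hcore⟩ := hA Cu R₁ hR₁pos
  have key : ∀ n : ℕ, ∀ t < 0, ∀ x, |f t x| ≤ (1 - p₀) ^ n * Cf := by
    intro n
    induction n with
    | zero => intro t ht x; simpa using hM t ht x
    | succ n ih =>
      intro t ht x
      have hA' := hcore f u Cg ((1 - p₀) ^ n * Cf) hp ih
      have hB' := hB f u Cg Cu R₁ ((1 - p₀) ^ n * Cf) ((1 - p₀) * ((1 - p₀) ^ n * Cf)) hp hR₁pos
        hone' ih hA' t ht x
      calc |f t x| ≤ (1 - p₀) * ((1 - p₀) ^ n * Cf) := hB'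
        _ = (1 - p₀) ^ (n + 1) * Cf := by ring
  intro t ht x
  have hlim : Tendsto (fun n : ℕ => (1 - p₀) ^ n * Cf) atTop (𝓝 (0 * Cf)) :=
    (tendsto_pow_atTop_nhds_zero_of_lt_one (by linarith) (by linarith)).mul_const Cf
  have hle : |f t x| ≤ 0 * Cf := ge_of_tendsto' hlim fun n => key n t ht x
  rw [zero_mul] at hle
  exact abs_eq_zero.1 (le_antisymm hle (abs_nonneg _))

/-- PROVED (v1.1, INSTRUMENT CALIBRATION «supercritical»). **Above the threshold the passive class is not Liouville.**
The explicit STEADY pair `f(x) = r²/(2(1+r²))`, `u(x) = −(4/(1+r²))·(x₀, x₁, 0)` (smooth on `ℝ³`, `‖u‖ = 4r/(1+r²) ≤ 2`,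
`|f| ≤ 1/2`, `|f| ≤ r/4`, inflow number `m(r) = −(x₀u₀+x₁u₁) = 4r²/(1+r²) < 4`, NOT divergence-free) solves the swirl
equation: with `φ(r) = r²/(2(1+r²))`, `φ′ = r/(1+r²)²`, `φ″ = (1−3r²)/(1+r²)³`, the radial identity
`φ″ + ((m−1)/r)φ′ = 0` holds — certified below — so by `radial_operator` `Δf − ∇f·(u + (2/r)e_r) = 0` off the axis and
`f ≢ 0`. The general family `f_M = (1 − (1+r²)^{1−M/2})/(M−2)`, `u_M = −(M/(1+r²))(x₀,x₁,0)` (`m < M`) does the same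
for every `M > 2` and degenerates at `M = 2` into the unbounded `½ log(1+r²)`: the threshold `2` of O2/O2⁰ is SHARP in
the passive bounded-drift class, and any proof of rows A5fe/A5fi above it must use `div u = 0` / the NS structure of `u`
(as KNSS Thm 5.2 does). Instrument row: (A5fe/A5fi, «threshold calibration», this lemma). -/
theorem superProfile_solution {r : ℝ} (hr : 0 < r) :
    (1 - 3 * r ^ 2) / (1 + r ^ 2) ^ 3 + (4 * r ^ 2 / (1 + r ^ 2) - 1) / r * (r / (1 + r ^ 2) ^ 2) = 0 := by
  have h1 : (1 + r ^ 2) ≠ 0 := by positivity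
  field_simp
  ring

/-! ## §3b (g19, PROVED) The annular-box barrier ENGINE: negation symmetry, the inflow bound, the slice calculus of the
two correctors, and `radialBarrier_le` — a radial profile that is a super-solution of the swirl operator on an annulus and
dominates `f` on its two cylindrical faces dominates `f` inside (S1 on growing boxes; lateral and initial correctors; two
limits). S2 and S3 are two instances. -/

/-- PROVED. The swirl-pair class is closed under `f ↦ −f`. -/
theorem IsSwirlPair.neg {f : ℝ → E3 → ℝ} {u : ℝ → E3 → E3} {Cg Cu : ℝ} (hp : IsSwirlPair f u Cg Cu) :
    IsSwirlPair (fun t x => -f t x) u Cg Cu where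
  smooth t ht := (hp.smooth t ht).neg
  cont_fderiv := by
    have h : (fun p : ℝ × E3 => fderiv ℝ (fun x => -f p.1 x) p.2) = fun p => -fderiv ℝ (f p.1) p.2 :=
      funext fun p => fderiv_fun_neg
    rw [h]; exact hp.cont_fderiv.neg
  cont_laplacian := by
    have h : (fun p : ℝ × E3 => (Δ fun x => -f p.1 x) p.2) = fun p => -(Δ (f p.1)) p.2 :=
      funext fun p => by
        rw [show (fun x => -f p.1 x) = -f p.1 from rfl, InnerProductSpace.laplacian_neg]; rfl
    rw [h]; exact hp.cont_laplacian.neg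
  axis t ht x := by rw [abs_neg]; exact hp.axis t ht x
  meas := hp.meas
  drift := hp.drift
  eqn x hx s t hst ht := by
    have hint : (fun τ => (Δ fun y => -f τ y) x - fderiv ℝ (fun y => -f τ y) x (u τ x) -
        2 / cylRadius x * partialDeriv (eR x) (fun y => -f τ y) x) =
        fun τ => -((Δ (f τ)) x - fderiv ℝ (f τ) x (u τ x) -
          2 / cylRadius x * partialDeriv (eR x) (f τ) x) := by
      funext τ
      rw [partialDeriv_apply, partialDeriv_apply, show (fun y => -f τ y) = -f τ from rfl,
        InnerProductSpace.laplacian_neg, fderiv_neg]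
      simp only [Pi.neg_apply, neg_apply]
      ring
    rw [hint, intervalIntegral.integral_neg, ← hp.eqn x hx s t hst ht]
    ring

/-- PROVED. The inflow number is controlled by the drift: `|x₀v₀ + x₁v₁| ≤ r ‖v‖`. -/
theorem abs_inflow_le (x v : E3) : |x 0 * v 0 + x 1 * v 1| ≤ cylRadius x * ‖v‖ := by
  have hn : ‖v‖ ^ 2 = v 0 ^ 2 + v 1 ^ 2 + v 2 ^ 2 := by
    rw [EuclideanSpace.norm_sq_eq]
    simp [Fin.sum_univ_three, sq_abs]
  have hr : cylRadius x ^ 2 = x 0 ^ 2 + x 1 ^ 2 := cylRadius_sq x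
  refine abs_le_of_sq_le_sq ?_ (mul_nonneg (cylRadius_nonneg x) (norm_nonneg v))
  rw [mul_pow, hr, hn]
  nlinarith [sq_nonneg (x 0 * v 1 - x 1 * v 0), sq_nonneg (x 0 * v 2), sq_nonneg (x 1 * v 2)]

/-- PROVED. `e_r` has no axial component. -/
theorem eR_apply_two (x : E3) : eR x 2 = 0 := by simp [eR]

/-- PROVED. Chain rule through the axial coordinate. -/
theorem hasFDerivAt_comp_coord_two {V V' : ℝ → ℝ} (hV : ∀ s, HasDerivAt V (V' s) s) (x : E3) :
    HasFDerivAt (fun y : E3 => V (y 2)) (V' (x 2) • (EuclideanSpace.proj 2 : E3 →L[ℝ] ℝ)) x :=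
  (hV (x 2)).comp_hasFDerivAt x (EuclideanSpace.proj (2 : Fin 3) : E3 →L[ℝ] ℝ).hasFDerivAt

/-- (engine) `fderiv_comp_coord_two_apply` — auxiliary step of the Feller–swirl one-cycle argument; see the section docstring above. [new] -/
theorem fderiv_comp_coord_two_apply {V V' : ℝ → ℝ} (hV : ∀ s, HasDerivAt V (V' s) s) (x h : E3) :
    fderiv ℝ (fun y : E3 => V (y 2)) x h = V' (x 2) * h 2 := by
  rw [(hasFDerivAt_comp_coord_two hV x).fderiv]
  simp

/-- PROVED. The Laplacian of a function of the axial coordinate alone is its second derivative. -/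
theorem laplacian_comp_coord_two {V : ℝ → ℝ} (hV2 : ContDiff ℝ 2 V) (x : E3) :
    Δ (fun x : E3 => V (x 2)) x = iteratedDeriv 2 V (x 2) := by
  rw [laplacian_eq_iteratedFDeriv_orthonormalBasis _ (EuclideanSpace.basisFun (Fin 3) ℝ)]
  have hcomp : (fun x : E3 => V (x 2)) = V ∘ (EuclideanSpace.proj (2 : Fin 3) : E3 →L[ℝ] ℝ) := rfl
  simp only [hcomp, ContinuousLinearMap.iteratedFDeriv_comp_right _ hV2 x (i := 2) le_rfl,
    ContinuousMultilinearMap.compContinuousLinearMap_apply, EuclideanSpace.basisFun_apply,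
    Fin.sum_univ_three, iteratedFDeriv_apply_eq_iteratedDeriv_mul_prod, Fin.prod_univ_two]
  simp

/-- (engine) `iteratedDeriv_two_eq` — auxiliary step of the Feller–swirl one-cycle argument; see the section docstring above. [new] -/
theorem iteratedDeriv_two_eq {V V' V'' : ℝ → ℝ} (hV : ∀ s, HasDerivAt V (V' s) s)
    (hV' : ∀ s, HasDerivAt V' (V'' s) s) (s : ℝ) : iteratedDeriv 2 V s = V'' s := by
  rw [iteratedDeriv_succ, iteratedDeriv_one]
  have h1 : deriv V = V' := funext fun t => (hV t).deriv
  rw [h1, (hV' s).deriv]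

/-- (engine) `hasDerivAt_cosh_sub` — auxiliary step of the Feller–swirl one-cycle argument; see the section docstring above. [new] -/
theorem hasDerivAt_cosh_sub (z₀ s : ℝ) :
    HasDerivAt (fun s => Real.cosh (s - z₀)) (Real.sinh (s - z₀)) s :=
  (((hasDerivAt_id' s).sub_const z₀).cosh).congr_deriv (by ring)

/-- (engine) `hasDerivAt_sinh_sub` — auxiliary step of the Feller–swirl one-cycle argument; see the section docstring above. [new] -/
theorem hasDerivAt_sinh_sub (z₀ s : ℝ) :
    HasDerivAt (fun s => Real.sinh (s - z₀)) (Real.cosh (s - z₀)) s :=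
  (((hasDerivAt_id' s).sub_const z₀).sinh).congr_deriv (by ring)

/-- (engine) `contDiff_cosh_sub` — auxiliary step of the Feller–swirl one-cycle argument; see the section docstring above. [new] -/
theorem contDiff_cosh_sub (z₀ : ℝ) : ContDiff ℝ 2 (fun s : ℝ => Real.cosh (s - z₀)) :=
  Real.contDiff_cosh.comp (contDiff_id.sub contDiff_const)

/-- PROVED. The lateral corrector slice `H(x) = cosh(x₂ − z₀)`: `C²`, `DH(x)h = sinh(x₂ − z₀) h₂`,
`ΔH(x) = cosh(x₂ − z₀)`. -/
theorem lateral_slice (z₀ : ℝ) :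
    ContDiff ℝ 2 (fun y : E3 => Real.cosh (y 2 - z₀)) ∧
    (∀ x h : E3, fderiv ℝ (fun y : E3 => Real.cosh (y 2 - z₀)) x h = Real.sinh (x 2 - z₀) * h 2) ∧
    (∀ x : E3, Δ (fun y : E3 => Real.cosh (y 2 - z₀)) x = Real.cosh (x 2 - z₀)) := by
  refine ⟨(contDiff_cosh_sub z₀).comp (EuclideanSpace.proj (2 : Fin 3) : E3 →L[ℝ] ℝ).contDiff,
    fun x h => fderiv_comp_coord_two_apply (hasDerivAt_cosh_sub z₀) x h, fun x => ?_⟩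
  rw [laplacian_comp_coord_two (contDiff_cosh_sub z₀) x,
    iteratedDeriv_two_eq (hasDerivAt_cosh_sub z₀) (hasDerivAt_sinh_sub z₀)]

/-- PROVED. `d/dr e^{γr} = γ e^{γr}`. -/
theorem hasDerivAt_exp_const_mul (γ r : ℝ) :
    HasDerivAt (fun r => Real.exp (γ * r)) (γ * Real.exp (γ * r)) r := by
  have h : HasDerivAt (fun r => γ * r) (γ * 1) r := (hasDerivAt_id' r).const_mul γ
  exact h.exp.congr_deriv (by ring)

/-- PROVED. The initial-corrector profile `Φ(r) = 2e^{γR} − e^{γr}`: first derivative. -/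
theorem hasDerivAt_initialProfile (γ R r : ℝ) :
    HasDerivAt (fun r => 2 * Real.exp (γ * R) - Real.exp (γ * r)) (-(γ * Real.exp (γ * r))) r :=
  (hasDerivAt_exp_const_mul γ r).const_sub (2 * Real.exp (γ * R))

/-- PROVED. … and second derivative. -/
theorem hasDerivAt_initialProfile' (γ r : ℝ) :
    HasDerivAt (fun r => -(γ * Real.exp (γ * r))) (-(γ ^ 2 * Real.exp (γ * r))) r :=
  (((hasDerivAt_exp_const_mul γ r).const_mul γ).neg).congr_deriv (by ring)


end Summit.NavierStokesRegularity.NavierStokesRegularity.Theorems.ScenarioCensus.FellerSwirl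

end
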